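import Summits.ResolutionOfSingularities.ResolutionOfSingularities.Theorems.EquisingularLiftEquisingularLiftNatSpecimenG3
import Mathlib.RingTheory.MvPolynomial.WeightedHomogeneous
import HarnessLib

/-!
# [OURS · L1 W4.5(b) · EL♮(3) · D-0157 DOOR 1, WIDTH row iso-w3 — «iso specimen pass»] THE DEGENERATE-FACE CERTIFICATE: a reusable kernel test for
# «NOT locally Newton-nondegenerate in the given coordinates»

OURS · L1 W4.5(b) · EL♮(3) stmt-ResolutionOfSingularities-20148 · counted 0 · AI-written (res-L1-w45b-iso-w3 g0, WIDTH TABLE D1′ row iso-w3 fallback «iso specimen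
pass», desk res-L1-w45b-plan-1 g21 2026-08-28T15:19:29Z), weaker than expert review; nothing of [Hironaka2017] asserted; no statement of the manuscript.
Sorry-free, standard axioms, DEF-FREE, no instance, no notation. `--supports stmt-ResolutionOfSingularities-20148 --as helper`.

WHAT. The tree's `IsLocallyNewtonNondegenerate` (…NatResidueHypDefsND §10.1, Kouchnirenko's condition at POSITIVE integer weights) fails for a polynomial `F`
as soon as ONE positive weight `w` cuts out an initial form with a singular torus point. This module turns that into a certificate that needs NO
monomial expansion: split `F = P + R` with `P` `w`-weighted-homogeneous of weight `m` (Mathlib `MvPolynomial.IsWeightedHomogeneous`, closed under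
`+`, `−`, `*`, `^`), every monomial of `R` of weight `> m`, and `P ≠ 0`; then `initialForm w F = P` (`initialForm_eq_of_split`), and a torus point at
which `P` and all `∂ᵢ P` vanish refutes local Newton nondegeneracy (`not_isLocallyNewtonNondegenerate_of_split`). The typical `P` is `Q₁ · Q₂²` with
`Q₂` vanishing at the torus point (`eval_pderiv_mul_sq_eq_zero`). Bridge `wt w d = Finsupp.weight w d` (`wt_eq_weight`). Small helpers for the
`R`-side (`lt_weight_of_isWeightedHomogeneous`, `lt_weight_add`) and `P ≠ 0` (`ne_zero_of_eval_ne_zero`).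
USED BY `…NatSpecimenM5Germs` (res-L1-w45b-lead-1's (m5) probe germs A, B, C, D1–D8, E1–E3, G1, G2; G3 = ✓ p642396). HONEST SCOPE: one coordinate system per
certificate; nothing about all charts / all origin-fixing automorphisms (`IsoHypND`), nothing scheme-level.
-/

noncomputable section

set_option linter.dupNamespace false

open MvPolynomial

namespace Summit.ResolutionOfSingularities.ResolutionOfSingularities.Cruxes.EquisingularLiftNat.Sections

variable {k : Type} [Field k] {N : ℕ}

/-- The tree's weight `wt w d = Σ wᵢ dᵢ` is Mathlib's `Finsupp.weight w d`. [OURS · L1 W4.5b · bridge] -/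
theorem wt_eq_weight (w : Fin N → ℤ) (d : Fin N →₀ ℕ) : wt w d = Finsupp.weight w d := by
  classical
  rw [Finsupp.weight_apply, wt]
  rw [← Finset.sum_subset (Finset.subset_univ d.support) (fun i _ hi => by
    rw [Finsupp.notMem_support_iff.1 hi]; simp)]
  refine Finset.sum_congr rfl fun i _ => ?_
  show w i * (d i : ℤ) = (d i) • w i
  rw [nsmul_eq_mul, mul_comm]

/-- A weighted-homogeneous piece of weight `m₁ > m` has all its monomials of weight `> m`. [OURS · L1 W4.5b · small print] -/
theorem lt_weight_of_isWeightedHomogeneous {w : Fin N → ℤ} {R₁ : MvPolynomial (Fin N) k} {m m₁ : ℤ} (h : IsWeightedHomogeneous w R₁ m₁)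
    (hlt : m < m₁) : ∀ d, coeff d R₁ ≠ 0 → m < Finsupp.weight w d :=
  fun _ hd => by rw [h hd]; exact hlt

/-- Sums keep «all monomials of weight `> m`». [OURS · L1 W4.5b · small print] -/
theorem lt_weight_add {w : Fin N → ℤ} {R₁ R₂ : MvPolynomial (Fin N) k} {m : ℤ} (h₁ : ∀ d, coeff d R₁ ≠ 0 → m < Finsupp.weight w d)
    (h₂ : ∀ d, coeff d R₂ ≠ 0 → m < Finsupp.weight w d) : ∀ d, coeff d (R₁ + R₂) ≠ 0 → m < Finsupp.weight w d := by
  intro d hd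
  rw [coeff_add] at hd
  by_cases h : coeff d R₁ = 0
  · exact h₂ d (by rwa [h, zero_add] at hd)
  · exact h₁ d h

/-- Differences of weighted-homogeneous polynomials of the same weight. [OURS · L1 W4.5b · small print] -/
theorem isWeightedHomogeneous_sub {w : Fin N → ℤ} {φ ψ : MvPolynomial (Fin N) k} {m : ℤ} (h₁ : IsWeightedHomogeneous w φ m)
    (h₂ : IsWeightedHomogeneous w ψ m) : IsWeightedHomogeneous w (φ - ψ) m := by
  rw [← mem_weightedHomogeneousSubmodule] at h₁ h₂ ⊢
  exact Submodule.sub_mem _ h₁ h₂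

/-- A polynomial with a non-zero value is non-zero. [OURS · small print] -/
theorem ne_zero_of_eval_ne_zero {P : MvPolynomial (Fin N) k} (x : Fin N → k) (h : eval x P ≠ 0) : P ≠ 0 :=
  fun h0 => h (by rw [h0, map_zero])

/-- **The initial form of a split `F = P + R`** (`P` weighted-homogeneous of weight `m` and non-zero, `R` of weights `> m`) **is `P`.** [OURS · L1 W4.5b] -/
theorem initialForm_eq_of_split (w : Fin N → ℤ) {F P R : MvPolynomial (Fin N) k} (hF : F = P + R) {m : ℤ} (hP : IsWeightedHomogeneous w P m)
    (hR : ∀ d, coeff d R ≠ 0 → m < Finsupp.weight w d) (hP0 : P ≠ 0) : initialForm w F = P := by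
  classical
  have hcoeff : ∀ d, coeff d F = coeff d P + coeff d R := fun d => by rw [hF, coeff_add]
  -- coefficients of weight `m` come from `P`, the others from `R`
  have hRm : ∀ d, Finsupp.weight w d = m → coeff d R = 0 := fun d hd => by
    by_contra h; have := hR d h; rw [hd] at this; exact lt_irrefl _ this
  have hPm : ∀ d, Finsupp.weight w d ≠ m → coeff d P = 0 := fun d hd => by
    by_contra h; exact hd (hP h)
  -- the support of `F` is nonempty and its minimal weight is `m`
  obtain ⟨d₀, hd₀⟩ := MvPolynomial.ne_zero_iff.1 hP0
  have hd₀m : Finsupp.weight w d₀ = m := hP hd₀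
  have hd₀F : d₀ ∈ F.support := by
    rw [mem_support_iff, hcoeff, hRm d₀ hd₀m, add_zero]; exact hd₀
  have hne : F.support.Nonempty := ⟨d₀, hd₀F⟩
  have hge : ∀ d ∈ F.support, m ≤ wt w d := by
    intro d hd
    rw [mem_support_iff, hcoeff] at hd
    rw [wt_eq_weight]
    by_cases hPd : coeff d P = 0
    · rw [hPd, zero_add] at hd; exact (hR d hd).le
    · exact (hP hPd).symm.le
  have hinf : F.support.inf' hne (wt w) = m :=
    le_antisymm ((Finset.inf'_le _ hd₀F).trans (by rw [wt_eq_weight, hd₀m])) (Finset.le_inf' _ _ hge)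
  ext d
  rw [coeff_initialForm w F hne, hinf, hcoeff, wt_eq_weight]
  by_cases hd : Finsupp.weight w d = m
  · rw [if_pos hd, hRm d hd, add_zero]
  · rw [if_neg hd, hPm d hd]

/-- **THE DEGENERATE-FACE CERTIFICATE.** `F = P + R` split as above at a POSITIVE weight, plus a torus point where `P` and all `∂ᵢ P` vanish
⟹ `F` is NOT locally Newton-nondegenerate (tree def `IsLocallyNewtonNondegenerate`). [OURS · L1 W4.5b] -/
theorem not_isLocallyNewtonNondegenerate_of_split (w : Fin N → ℤ) (hw : ∀ i, 0 < w i) {F P R : MvPolynomial (Fin N) k} (hF : F = P + R)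
    {m : ℤ} (hP : IsWeightedHomogeneous w P m) (hR : ∀ d, coeff d R ≠ 0 → m < Finsupp.weight w d) (hP0 : P ≠ 0)
    (x : Fin N → k) (hx : ∀ i, x i ≠ 0) (h0 : eval x P = 0) (h1 : ∀ i, eval x (pderiv i P) = 0) :
    ¬ IsLocallyNewtonNondegenerate F := by
  intro h
  refine h w hw x hx ?_ ?_
  · rw [initialForm_eq_of_split w hF hP hR hP0]; exact h0
  · intro i; rw [initialForm_eq_of_split w hF hP hR hP0]; exact h1 i

/-- `Q₁ · Q₂²` vanishes where `Q₂` does. [OURS · small print] -/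
theorem eval_mul_sq_eq_zero (x : Fin N → k) (Q₁ Q₂ : MvPolynomial (Fin N) k) (h : eval x Q₂ = 0) : eval x (Q₁ * Q₂ ^ 2) = 0 := by
  rw [map_mul, map_pow, h]; ring

/-- Every partial derivative of `Q₁ · Q₂²` vanishes where `Q₂` does. [OURS · small print] -/
theorem eval_pderiv_mul_sq_eq_zero (x : Fin N → k) (Q₁ Q₂ : MvPolynomial (Fin N) k) (h : eval x Q₂ = 0) (i : Fin N) :
    eval x (pderiv i (Q₁ * Q₂ ^ 2)) = 0 := by
  rw [Derivation.leibniz, sq, Derivation.leibniz]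
  simp only [smul_eq_mul, map_add, map_mul, h]
  ring

/-- The pure-square case `P = Q²`. [OURS · small print] -/
theorem eval_pderiv_sq_eq_zero (x : Fin N → k) (Q : MvPolynomial (Fin N) k) (h : eval x Q = 0) (i : Fin N) :
    eval x (pderiv i (Q ^ 2)) = 0 := by
  have := eval_pderiv_mul_sq_eq_zero x 1 Q h i
  rwa [one_mul] at this

end Summit.ResolutionOfSingularities.ResolutionOfSingularities.Cruxes.EquisingularLiftNat.Sections

end
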